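import Literature.NumberTheory.EllipticCurves.HasseWeilAbelianEulerFactorHoldsProofs
import Literature.NumberTheory.EllipticCurves.DivisionFieldRamificationPrimePowProofs
import Literature.NumberTheory.EllipticCurves.MultiplicativeTransvectionPrimeToVProofs
import Literature.NumberTheory.EllipticCurves.NeronOggShafarevichLocal
import Literature.NumberTheory.EllipticCurves.KrausOesterle1992.TorsionCongruenceCriterionHasseWeilProofs
import Literature.NumberTheory.EllipticCurves.LocalTorsionMultiplicativeProofs
import Literature.NumberTheory.EllipticCurves.Rank1Residual.Predicates
import HarnessLib

/-!
# Route `AdditiveKolyvaginRoad`, crux `LevelKolyvaginSystemsAdditive` (item stmt-BirchSwinnertonDyer-21396, KS′),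
# line `epsilon_matched_retyping`: the locus clause (i) SIGN AGREEMENT is AUTOMATIC —
# `a_ℓ(E) = a_ℓ(E₀)` at the common multiplicative primes of two curves with `E[p] ≅ E₀[p]` and Hypothesis ♠(1)
# (cell `pub/bsd-wall`, width seat `bsd-wall-akr-p2x-w3` g5; `--supports stmt-BirchSwinnertonDyer-21396`, helper)

WHY. The lead's skeleton v3 of the line (`Cruxes/LevelKolyvaginSystemsAdditive/Lines/epsilon_matched_retyping.lean`,
sha16 0ec7e4aa) carries in its (γ)-avatar locus — and hence, negated, in the residual stub `stub_offAvatarLocus` — the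
clause `hsign : ∀ ℓ, W₀.HasMultiplicativeReductionAtPrime ℓ → W.LFunction ℓ = W₀.LFunction ℓ` (sign agreement of
`E` and its avatar `E₀` at the multiplicative primes; consumed by `AdditiveKoly.depletionPrimes_eq_singleton_of_sign`,
p605510, to make Kriz–Li's depletion set `{p}`).  This file PROVES that clause from data the locus already carries:
the `Γ_ℚ`-equivariant isomorphism `e : E[p] ≃ E₀[p]`, `htype` (same multiplicative primes), `Addv W p`, and
Hypothesis ♠(1) for the avatar (`p ∤ ord_ℓ Δ_min(E₀)` at every multiplicative `ℓ`).  The lead may therefore derive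
`hsign` inside the composition and drop it from the locus (smaller residual).

MATHEMATICS (Serre–Tate 1968 §1 Lemma 2 on torsion points at a multiplicative place; Silverman *ATAEC* V.4–V.6,
Ex. 5.13; Darmon–Diamond–Taylor Prop. 2.12 (c); the clause Kraus–Oesterlé 1992 Prop. 4 leave to their exceptional
set `S`).  Let `ℓ ≠ p` be multiplicative for both curves, `𝔓 ∣ ℓ` a prime of `\bar ℤ`, `σ` an arithmetic Frobenius
at `𝔓`.  (1) On the TATE LINE `E[p]^{I_𝔓}` the Frobenius acts by `ε·ℓ`, `ε = a_ℓ(E) = ±1` (split ∕ non-split):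
the tree's theorems `serreTate_frobenius_smul_torsion_of_has{Split,Nonsplit}MultiplicativeReductionAt_holds` give
`σ(cP) = ±ℓ·(cP)` for `I_𝔓`-fixed `P ∈ E[p^∞]` and some `c ≠ 0`; feeding them the inertia-fixed Tate point of order
`p^{v_p(c)+1}` (`exists_tateBasis_geomTorsion_of_hasMultiplicativeReductionAt`) yields a NON-ZERO `Q ∈ E[p]^{I_𝔓}` with
`σ Q = ε ℓ Q` (§2).  (2) Under ♠(1) for `E₀` the inertia group MOVES `E₀[p]` (`exists_inertia_smul_ne_of_
hasMultiplicativeReductionAt_of_not_dvd`, restricted into the global inertia group along `resGalOfEmb_mem_inertia_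
primeBelow`, §1), so `E₀[p]^{I_𝔓}` is a proper subgroup of the order-`p²` group `E₀[p]`, hence cyclic of order `≤ p`,
and any two of its non-zero elements are proportional (§3).  (3) `e` maps `E`'s eigenvector `Q` (eigenvalue `ε ℓ`)
to a non-zero element of `E₀[p]^{I_𝔓}`, proportional to `E₀`'s eigenvector (eigenvalue `ε₀ ℓ`); so
`ε ℓ e(Q) = ε₀ ℓ e(Q)`, and a mismatch `ε ≠ ε₀` would give `2ℓ · e(Q) = 0` with `p · e(Q) = 0`, `p ∤ 2ℓ` — absurd (§4).
(4) `a_ℓ = 1 ∕ −1` at split ∕ non-split multiplicative `ℓ` (`KrausOesterle1992.lFunction_apply_prime_eq_one_of_…`,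
`…_eq_neg_one_of_not_split`).  Without ♠(1) the conclusion fails exactly at `ℓ ≡ −1 (mod p)` (Kraus–Oesterlé's set
`S`), which is why K–O Prop. 3 (iii) does not state it; ♠(1) is part of every frame of the route.

RESULTS. §1 `exists_inertia_smul_ne_geomTorsion_of_not_dvd_ordMinimalDiscriminant` (number field `K`, any `𝔓 ∣ v`);
§2 `exists_inertiaFixed_frobenius_eigenvector_geomTorsion` (number field `K`, `v ∤ p` multiplicative: a non-zero
`I_𝔓`-fixed `Q ∈ E[p]` with `σ Q = N v · Q` if split, `σ Q = −(N v · Q)` if non-split); §3 the cyclic lemma; §4 over `ℚ`: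
`lFunction_eq_of_addEquiv_geomTorsion_of_hasMultiplicativeReductionAtPrime` and the crux-currency corollary
`sign_agreement_of_torsionCongr` (= the locus clause `hsign` from `hsp₀`, `htype`, `hadd`, `e`).

HONEST FRAMING: theorems only; 0 definitions, 0 named facts, 0 `sorry`; closes nothing by itself (a helper for the
line's composition).  BSD is not proved by any of this; KS′ is not proved by any of this.

References: [cite: SerreTate1968, §1 Lemma 1, Lemma 2 (p. 495)] [cite: SilvermanATAEC1994, V.4–V.6, Exercise 5.13 (a)(b),
Prop. 6.1] [cite: DarmonDiamondTaylor1995, Prop. 2.12 (c)] [cite: KrausOesterle1992, §3 Lemme 1, Prop. 3, Prop. 4 (the set S)]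
[cite: SilvermanAEC2009, §C.16, Exercise 3.5 (a)].
-/

-- single-conjunct summit: `Summit.BirchSwinnertonDyer.BirchSwinnertonDyer.…` repeats the name by design
set_option linter.dupNamespace false

noncomputable section

open scoped Classical NumberField Pointwise

universe u

namespace Summit.BirchSwinnertonDyer.BirchSwinnertonDyer.Theorems.AdditiveKoly

open WeierstrassCurve NumberField IsDedekindDomain IsDedekindDomain.HeightOneSpectrum Field
  Literature.NumberTheory.EllipticCurves Literature.NumberTheory.GaloisRepresentations

/-! ## §1 Hypothesis ♠(1) read globally: the inertia group of `𝔓 ∣ v` moves `E[p]` -/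

section Ramified

variable {K : Type u} [Field K] [NumberField K] (W : WeierstrassCurve K) [W.IsElliptic]

/-- **`E[p]` is ramified at a multiplicative place `v ∤ p` with `p ∤ ord_v(Δ_min)` — global form.**  For `E/K`
elliptic over a number field, `v` a finite place of multiplicative reduction, `p` a prime with `v ∤ p` and
`p ∤ ord_v(Δ_min)`, and ANY prime `𝔓` of `\bar ℤ_K` above `v`: some element of the inertia group `I_𝔓 ≤ Γ_K` moves
some point of `E[p] = E(K̄)[p]`.  Proof: the local statement (`exists_inertia_smul_ne_of_hasMultiplicativeReductionAt_
of_not_dvd`: some `τ ∈ I_𝔐 ≤ Γ_{K_v}` moves a `p`-torsion point of `E(K̄_v)`) transported along an embedding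
`ι : K̄ → K̄_v` cutting out `𝔓` (`I_𝔐` restricts into `I_𝔓`, `resGalOfEmb_mem_inertia_primeBelow`; torsion of `E(K̄_v)`
comes from `E(K̄)`, `exists_pointsMapOfEmb_eq_of_nsmul_eq_zero`; equivariance `pointsMapOfEmb_smul`).
[cite: SilvermanATAEC1994, Exercise 5.13 (b), Prop. V.6.1] [cite: NeukirchANT1999, Ch. II §9 Prop. (9.6)] -/
theorem exists_inertia_smul_ne_geomTorsion_of_not_dvd_ordMinimalDiscriminant
    {v : HeightOneSpectrum (𝓞 K)} (hmult : W.HasMultiplicativeReductionAt v) {p : ℕ} (hp : p.Prime)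
    (hpv : (p : 𝓞 K) ∉ v.asIdeal) (hndvd : ¬ p ∣ W.ordMinimalDiscriminant v)
    {𝔓 : Ideal (absIntegers (𝓞 K) K)} (h𝔓 : 𝔓 ∈ v.primesAbove) :
    ∃ τ ∈ 𝔓.inertia (absoluteGaloisGroup K), ∃ Q : geomTorsion W (p : ℤ), τ • Q ≠ Q := by
  obtain ⟨w, hw⟩ := v.exists_spectralValuation
  obtain ⟨𝔐, h𝔐⟩ := v.localPrimesAbove_nonempty
  -- arrange `𝔓 = 𝔓_{ι,𝔐}` for an embedding `ι : K̄ → K̄_v`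
  obtain ⟨g, hg⟩ := HeightOneSpectrum.exists_smul_eq_of_mem_primesAbove_holds
    (HeightOneSpectrum.primeBelow_mem_primesAbove
      (ι := closureEmb (K := K) (v.adicCompletion K)) h𝔐) h𝔓
  set ι : AlgebraicClosure K →ₐ[K] AlgebraicClosure (v.adicCompletion K) :=
    (closureEmb (K := K) (v.adicCompletion K)).comp
      ((show AlgebraicClosure K ≃ₐ[K] AlgebraicClosure K from g⁻¹) :
        AlgebraicClosure K →ₐ[K] AlgebraicClosure K) with hι
  have h1 : 𝔓 = v.primeBelow ι 𝔐 := by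
    rw [hι, HeightOneSpectrum.primeBelow_comp, ← hg]
    exact congrArg (· • _) (inv_inv g).symm
  -- the local ramification
  obtain ⟨τ, hτ, Q, hpQ, hτQ⟩ :=
    W.exists_inertia_smul_ne_of_hasMultiplicativeReductionAt_of_not_dvd hmult hp hpv hndvd hw h𝔐
  obtain ⟨P₀, hpP₀, hP₀Q⟩ := exists_pointsMapOfEmb_eq_of_nsmul_eq_zero W ι hp.ne_zero hpQ
  have hmem : P₀ ∈ geomTorsion W (p : ℤ) :=
    (Submodule.mem_torsionBy_iff _ _).mpr (by rw [natCast_zsmul]; exact hpP₀)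
  refine ⟨resGalOfEmb ι τ, h1 ▸ v.resGalOfEmb_mem_inertia_primeBelow ι 𝔐 hτ, ⟨P₀, hmem⟩, fun h ↦ hτQ ?_⟩
  have h' := congrArg (fun R : geomTorsion W (p : ℤ) ↦ pointsMapOfEmb W ι (R : geomPoints W)) h
  simp only [Literature.NumberTheory.EllipticCurves.AddSubgroup.torsionBy.coe_smul, pointsMapOfEmb_smul] at h'
  rw [← hP₀Q]
  exact h'

end Ramified

/-! ## §2 The Frobenius eigenvector on the Tate line -/

section Eigenvector

variable {K : Type u} [Field K] [NumberField K] (W : WeierstrassCurve K) [W.IsElliptic]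

/-- **From a Serre–Tate torsion datum to a non-zero inertia-fixed eigenvector in `E[p]`.**  Let `v ∤ p` be a
multiplicative place, `𝔓 ∣ v`, and suppose (the shape of the tree's Serre–Tate torsion facts) that for some `c ≠ 0`
and some map `f`, `σ(c P) = f(c P)` for every `I_𝔓`-fixed `P ∈ E(K̄)` of `p`-power order.  Then there is a NON-ZERO
`I_𝔓`-fixed `Q ∈ E[p]` with `σ Q = f Q`: take the inertia-fixed Tate point `P₁` of exact order `p^{k+1}`,
`p^k ∥ c` (`exists_tateBasis_geomTorsion_of_hasMultiplicativeReductionAt`), and `Q = c P₁` (of exact order `p`).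
[cite: SerreTate1968, §1 Lemma 2] [cite: SilvermanATAEC1994, Exercise 5.13 (a)(b)] -/
theorem exists_inertiaFixed_geomTorsion_of_serreTate {v : HeightOneSpectrum (𝓞 K)}
    (hmult : W.HasMultiplicativeReductionAt v) {p : ℕ} (hp : p.Prime) (hpv : (p : 𝓞 K) ∉ v.asIdeal)
    {𝔓 : Ideal (absIntegers (𝓞 K) K)} (h𝔓 : 𝔓 ∈ v.primesAbove) {σ : absoluteGaloisGroup K}
    {f : geomPoints W → geomPoints W} {c : ℕ} (hc : c ≠ 0)
    (hST : ∀ (n : ℕ) (P : geomPoints W), (∀ τ ∈ 𝔓.inertia (absoluteGaloisGroup K), τ • P = P) →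
      p ^ n • P = 0 → σ • (c • P) = f (c • P)) :
    ∃ Q : geomTorsion W (p : ℤ), Q ≠ 0 ∧ (∀ τ ∈ 𝔓.inertia (absoluteGaloisGroup K), τ • Q = Q) ∧
      σ • (Q : geomPoints W) = f Q := by
  -- `c = p^k c'`, `p ∤ c'`
  obtain ⟨k, c', hc', rfl⟩ := Nat.exists_eq_pow_mul_and_not_dvd hc p hp.ne_one
  -- the inertia-fixed Tate point of exact order `p^(k+1)`
  obtain ⟨P₁, _P₂, hP₁ord, -, hP₁τ⟩ :=
    W.exists_tateBasis_geomTorsion_of_hasMultiplicativeReductionAt hmult hp hpv (n := k + 1) (by omega) h𝔓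
  rw [Nat.add_sub_cancel] at hP₁ord
  have hP₁pow : p ^ (k + 1) • (P₁ : geomPoints W) = 0 := by
    rw [← natCast_zsmul]
    exact (Submodule.mem_torsionBy_iff _ _).mp P₁.2
  have hP₁fix : ∀ τ ∈ 𝔓.inertia (absoluteGaloisGroup K), τ • (P₁ : geomPoints W) = P₁ := fun τ hτ ↦ by
    have := congrArg (fun R : geomTorsion W ((p ^ (k + 1) : ℕ) : ℤ) ↦ (R : geomPoints W)) (hP₁τ τ hτ).1
    simpa only [Literature.NumberTheory.EllipticCurves.AddSubgroup.torsionBy.coe_smul] using this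
  -- `Q = c P₁` has order `p` and is non-zero
  set Q₀ : geomPoints W := (p ^ k * c') • (P₁ : geomPoints W) with hQ₀
  have hpQ₀ : p • Q₀ = 0 := by
    rw [hQ₀, ← mul_nsmul', show p * (p ^ k * c') = c' * p ^ (k + 1) by ring, mul_nsmul', hP₁pow,
      nsmul_zero]
  have hQ₀ne : Q₀ ≠ 0 := by
    intro h0
    apply hP₁ord
    -- the order of `P₁` is `p^j`, `j ≤ k+1`; `p^k c' P₁ = 0` with `p ∤ c'` forces `j ≤ k`
    have hord : addOrderOf (P₁ : geomPoints W) ∣ p ^ (k + 1) := addOrderOf_dvd_of_nsmul_eq_zero hP₁pow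
    obtain ⟨j, hj, hjeq⟩ := (Nat.dvd_prime_pow hp).mp hord
    have hdvd : addOrderOf (P₁ : geomPoints W) ∣ p ^ k * c' := addOrderOf_dvd_of_nsmul_eq_zero h0
    rw [hjeq] at hdvd
    have hjk : p ^ j ∣ p ^ k :=
      ((Nat.Coprime.pow_left j ((Nat.Prime.coprime_iff_not_dvd hp).mpr hc')).dvd_mul_right).mp hdvd
    apply Subtype.ext
    rw [AddSubmonoidClass.coe_nsmul, ZeroMemClass.coe_zero]
    exact addOrderOf_dvd_iff_nsmul_eq_zero.mp (hjeq ▸ hjk)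
  have hQ₀fix : ∀ τ ∈ 𝔓.inertia (absoluteGaloisGroup K), τ • Q₀ = Q₀ := fun τ hτ ↦ by
    rw [hQ₀, smul_comm, hP₁fix τ hτ]
  have hQ₀mem : Q₀ ∈ geomTorsion W (p : ℤ) :=
    (Submodule.mem_torsionBy_iff _ _).mpr (by rw [natCast_zsmul]; exact hpQ₀)
  refine ⟨⟨Q₀, hQ₀mem⟩, fun h ↦ hQ₀ne (congrArg Subtype.val h), fun τ hτ ↦ Subtype.ext ?_, ?_⟩
  · rw [Literature.NumberTheory.EllipticCurves.AddSubgroup.torsionBy.coe_smul]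
    exact hQ₀fix τ hτ
  · exact hST (k + 1) P₁ hP₁fix hP₁pow

/-- **The Frobenius eigenvector on the Tate line** (Serre–Tate 1968 §1 Lemma 2 on torsion points; Silverman *ATAEC*
Ex. 5.13).  For `E/K` elliptic over a number field, `v ∤ p` a place of multiplicative reduction, `𝔓 ∣ v` and `σ` an
arithmetic Frobenius at `𝔓`: there is a NON-ZERO `I_𝔓`-fixed `Q ∈ E[p] = E(K̄)[p]` on which `σ` acts as `N v` if the
reduction is SPLIT and as `−N v` if it is NON-SPLIT.  From the tree's theorems
`serreTate_frobenius_smul_torsion_of_has{Split,Nonsplit}MultiplicativeReductionAt_holds` fed with the Tate point of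
order `p^{v_p(c)+1}` (`exists_inertiaFixed_geomTorsion_of_serreTate`).
[cite: SerreTate1968, §1 Lemma 1, Lemma 2 (p. 495)] [cite: SilvermanATAEC1994, Exercise 5.13 (a)(b)]
[cite: SilvermanAEC2009, Exercise 3.5 (a)] -/
theorem exists_inertiaFixed_frobenius_eigenvector_geomTorsion {v : HeightOneSpectrum (𝓞 K)}
    (hmult : W.HasMultiplicativeReductionAt v) {p : ℕ} [hp : Fact p.Prime] (hpv : (p : 𝓞 K) ∉ v.asIdeal)
    {𝔓 : Ideal (absIntegers (𝓞 K) K)} (h𝔓 : 𝔓 ∈ v.primesAbove) {σ : absoluteGaloisGroup K}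
    (hσ : IsArithFrobAt (𝓞 K) σ 𝔓) :
    ∃ Q : geomTorsion W (p : ℤ), Q ≠ 0 ∧ (∀ τ ∈ 𝔓.inertia (absoluteGaloisGroup K), τ • Q = Q) ∧
      ((W.HasSplitMultiplicativeReductionAt v ∧ σ • Q = v.residueCard • Q) ∨
        (¬ W.HasSplitMultiplicativeReductionAt v ∧ σ • Q = -(v.residueCard • Q))) := by
  by_cases hs : W.HasSplitMultiplicativeReductionAt v
  · obtain ⟨c, hc, h⟩ :=
      W.serreTate_frobenius_smul_torsion_of_hasSplitMultiplicativeReductionAt_holds p v hpv hs h𝔓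
    obtain ⟨Q, hQne, hQfix, hQσ⟩ := exists_inertiaFixed_geomTorsion_of_serreTate W hmult hp.out hpv h𝔓 hc
      (f := fun x ↦ v.residueCard • x) (fun n P hP hPn ↦ h hσ n P hP hPn)
    refine ⟨Q, hQne, hQfix, Or.inl ⟨hs, Subtype.ext ?_⟩⟩
    rw [Literature.NumberTheory.EllipticCurves.AddSubgroup.torsionBy.coe_smul, AddSubmonoidClass.coe_nsmul]
    exact hQσ
  · obtain ⟨c, hc, h⟩ :=
      W.serreTate_frobenius_smul_torsion_of_hasNonsplitMultiplicativeReductionAt_holds p v hpv hmult hs h𝔓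
    obtain ⟨Q, hQne, hQfix, hQσ⟩ := exists_inertiaFixed_geomTorsion_of_serreTate W hmult hp.out hpv h𝔓 hc
      (f := fun x ↦ -(v.residueCard • x)) (fun n P hP hPn ↦ h hσ n P hP hPn)
    refine ⟨Q, hQne, hQfix, Or.inr ⟨hs, Subtype.ext ?_⟩⟩
    rw [Literature.NumberTheory.EllipticCurves.AddSubgroup.torsionBy.coe_smul, NegMemClass.coe_neg,
      AddSubmonoidClass.coe_nsmul]
    exact hQσ

end Eigenvector

/-! ## §3 A proper inertia-fixed subgroup of an order-`p²` group is the line through any of its non-zero points -/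

section Cyclic

variable {G : Type*} {A : Type*} [Group G] [AddCommGroup A] [DistribMulAction G A]

/-- **The fixed subgroup is a line.**  Let `G` act additively on an abelian group `A` of order `p²` (`p` prime) and
`I ⊆ G`.  If some `τ₀ ∈ I` moves some `R ∈ A`, then every `I`-fixed `Q'` lies on the line `ℤ Q₀` through any NON-ZERO
`I`-fixed `Q₀` with `p Q₀ = 0`: the subgroup generated by `Q₀, Q'` is `I`-fixed pointwise, hence proper (it misses
`R`), hence of order `p`, hence equal to `ℤ Q₀`.  (Applied to `A = E₀[p]`, `I = I_𝔓`.) [folklore] -/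
theorem mem_zmultiples_of_fixed_of_moved {p : ℕ} (hp : p.Prime) (hA : Nat.card A = p ^ 2) (I : Set G)
    {Q₀ Q' R : A} (hQ₀ : Q₀ ≠ 0) (hpQ₀ : p • Q₀ = 0) (hQ₀fix : ∀ τ ∈ I, τ • Q₀ = Q₀)
    (hQ'fix : ∀ τ ∈ I, τ • Q' = Q') {τ₀ : G} (hτ₀ : τ₀ ∈ I) (hR : τ₀ • R ≠ R) :
    Q' ∈ AddSubgroup.zmultiples Q₀ := by
  haveI : Finite A := Nat.finite_of_card_ne_zero (by rw [hA]; exact pow_ne_zero 2 hp.ne_zero)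
  set H : AddSubgroup A := AddSubgroup.closure ({Q₀, Q'} : Set A) with hH
  -- `H` is fixed pointwise by `I`
  have hfix : ∀ x ∈ H, ∀ τ ∈ I, τ • x = x := by
    intro x hx
    induction hx using AddSubgroup.closure_induction with
    | mem y hy =>
      rcases hy with rfl | hy
      · exact hQ₀fix
      · rw [Set.mem_singleton_iff] at hy
        subst hy
        exact hQ'fix
    | zero => exact fun τ _ ↦ smul_zero τ
    | add x y _ _ hx hy => exact fun τ hτ ↦ by rw [smul_add, hx τ hτ, hy τ hτ]
    | neg x _ hx => exact fun τ hτ ↦ by rw [smul_neg, hx τ hτ]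
  -- hence proper
  have hHne : H ≠ ⊤ := fun htop ↦ hR (hfix R (htop ▸ AddSubgroup.mem_top R) τ₀ hτ₀)
  -- its order is `p^i`, `i ≤ 2`, `i ≠ 2`; it contains the line `ℤ Q₀` of order `p`, so `i = 1` and `H = ℤ Q₀`
  have hcardH : Nat.card H ∣ p ^ 2 := hA ▸ H.card_addSubgroup_dvd_card
  obtain ⟨i, hi, hHi⟩ := (Nat.dvd_prime_pow hp).mp hcardH
  have hQ₀H : Q₀ ∈ H := AddSubgroup.subset_closure (Set.mem_insert Q₀ _)
  have hQ'H : Q' ∈ H := AddSubgroup.subset_closure (Set.mem_insert_of_mem Q₀ rfl)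
  have hle : AddSubgroup.zmultiples Q₀ ≤ H := (AddSubgroup.zmultiples_le (G := A)).mpr hQ₀H
  haveI : Fact p.Prime := ⟨hp⟩
  have hordQ₀ : addOrderOf Q₀ = p := addOrderOf_eq_prime hpQ₀ hQ₀
  have hcardZ : Nat.card (AddSubgroup.zmultiples Q₀) = p := by rw [Nat.card_zmultiples, hordQ₀]
  have hi2 : i ≠ 2 := fun h2 ↦ hHne (AddSubgroup.eq_top_of_card_eq H (by rw [hHi, h2, hA]))
  have hpi : p ∣ p ^ i := by
    have h := AddSubgroup.card_dvd_of_le hle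
    rwa [hcardZ, hHi] at h
  have hi0 : i ≠ 0 := fun h0 ↦ hp.one_lt.ne' (Nat.dvd_one.mp (by rwa [h0, pow_zero] at hpi))
  have hi1 : i = 1 := by omega
  have heq : AddSubgroup.zmultiples Q₀ = H :=
    AddSubgroup.eq_of_le_of_card_ge hle (by rw [hHi, hi1, pow_one, hcardZ])
  rw [heq]
  exact hQ'H

end Cyclic

/-! ## §4 Over `ℚ`: sign agreement at the common multiplicative primes -/

section OverQ

open Rat.HeightOneSpectrum

/-- **`a_ℓ(E) = a_ℓ(E₀)` at a common multiplicative prime `ℓ ≠ p` of two curves with `Γ_ℚ`-isomorphic `p`-torsion,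
`p` odd, when `E₀[p]` is ramified at `ℓ` (`p ∤ ord_ℓ Δ_min(E₀)`, Hypothesis ♠(1)).**  For `W, W₀ /ℚ` elliptic (`W₀` a
global minimal model), `p ≠ 2` prime, `e : W[p] ≃+ W₀[p]` `Γ_ℚ`-equivariant, `ℓ ≠ p` a prime of multiplicative
reduction for both with `p ∤ v_ℓ(Δ_min(W₀))`: `W.LFunction ℓ = W₀.LFunction ℓ` (both `= 1` or both `= −1`, i.e. the
two reductions are simultaneously split or non-split).  Proof in the module docstring: Frobenius eigenvectors on the
two Tate lines (§2), the fixed line of `E₀[p]` under `I_𝔓` (§1, §3), and `p ∤ 2ℓ`.  Darmon–Diamond–Taylor Prop. 2.12 (c)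
(`ρ̄|_{G_ℓ} ≅ (χ ω *; 0 χ)`, `χ` unramified with `χ(Frob_ℓ) = a_ℓ`); outside ♠(1) the statement fails exactly at
`ℓ ≡ −1 (mod p)` (Kraus–Oesterlé's set `S`).
[cite: DarmonDiamondTaylor1995, Prop. 2.12 (c)] [cite: SerreTate1968, §1 Lemma 2] [cite: KrausOesterle1992, §3 Lemme 1, Prop. 4]
[cite: SilvermanATAEC1994, Exercise 5.13, Prop. V.6.1] -/
theorem lFunction_eq_of_addEquiv_geomTorsion_of_hasMultiplicativeReductionAtPrime
    (W W₀ : WeierstrassCurve ℚ) [W.IsElliptic] [W₀.IsElliptic] [W₀.IsGloballyMinimal]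
    (p : ℕ) [hp : Fact p.Prime] (hp2 : p ≠ 2)
    (e : geomTorsion W (p : ℤ) ≃+ geomTorsion W₀ (p : ℤ))
    (he : ∀ (σ : absoluteGaloisGroup ℚ) (P : geomTorsion W (p : ℤ)), e (σ • P) = σ • e P)
    (ℓ : ℕ) [hℓ : Fact ℓ.Prime] (hℓp : ℓ ≠ p)
    (hW : W.HasMultiplicativeReductionAtPrime ℓ) (hW₀ : W₀.HasMultiplicativeReductionAtPrime ℓ)
    (hram : ¬ p ∣ padicValInt ℓ W₀.minimalDiscriminantInt) :
    W.LFunction ℓ = W₀.LFunction ℓ := by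
  -- the place `v` of `ℚ` at `ℓ`
  obtain ⟨v, hv⟩ : ∃ v : HeightOneSpectrum (𝓞 ℚ), (primesEquiv v : ℕ) = ℓ :=
    ⟨primesEquiv.symm ⟨ℓ, hℓ.out⟩, by rw [Equiv.apply_symm_apply]⟩
  subst hv
  have hmv : W.HasMultiplicativeReductionAt v :=
    (W.hasMultiplicativeReductionAtPrime_iff_hasMultiplicativeReductionAt_ringOfIntegers v).mp hW
  have hmv₀ : W₀.HasMultiplicativeReductionAt v :=
    (W₀.hasMultiplicativeReductionAtPrime_iff_hasMultiplicativeReductionAt_ringOfIntegers v).mp hW₀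
  have hpv : (p : 𝓞 ℚ) ∉ v.asIdeal := fun h ↦
    hℓp ((Nat.prime_dvd_prime_iff_eq (primesEquiv v).2 hp.out).mp ((Rat.natCast_mem_asIdeal_iff v).mp h))
  have hndvd : ¬ p ∣ W₀.ordMinimalDiscriminant v := by
    rwa [LocalTorsionMult.ordMinimalDiscriminant_eq_padicValInt W₀ v rfl]
  have hres : v.residueCard = (primesEquiv v : ℕ) := Rat.residueCard_eq_natGenerator v
  obtain ⟨𝔓, h𝔓⟩ := v.primesAbove_nonempty
  obtain ⟨σ, hσ⟩ := HeightOneSpectrum.exists_isArithFrobAt_of_mem_primesAbove_holds (v := v) h𝔓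
  -- the two Frobenius eigenvectors and the ramification of `E₀[p]`
  obtain ⟨Q, hQne, hQfix, hQσ⟩ := exists_inertiaFixed_frobenius_eigenvector_geomTorsion W hmv hpv h𝔓 hσ
  obtain ⟨Q₀, hQ₀ne, hQ₀fix, hQ₀σ⟩ :=
    exists_inertiaFixed_frobenius_eigenvector_geomTorsion W₀ hmv₀ hpv h𝔓 hσ
  obtain ⟨τ, hτ, R, hR⟩ :=
    exists_inertia_smul_ne_geomTorsion_of_not_dvd_ordMinimalDiscriminant W₀ hmv₀ hp.out hpv hndvd h𝔓
  -- transport `Q` along `e`: an `I_𝔓`-fixed non-zero point of `E₀[p]`, hence on the line `ℤ Q₀`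
  have hQ'ne : e Q ≠ 0 := (map_ne_zero_iff e e.injective).mpr hQne
  have hQ'fix : ∀ τ ∈ 𝔓.inertia (absoluteGaloisGroup ℚ), τ • e Q = e Q := fun τ hτ ↦ by
    rw [← he, hQfix τ hτ]
  have hcard : Nat.card (geomTorsion W₀ (p : ℤ)) = p ^ 2 :=
    card_torsionPoints_eq_sq_holds W₀ (AlgebraicClosure ℚ) (n := p) (by exact_mod_cast hp.out.ne_zero)
  have hpT : ∀ T : geomTorsion W₀ (p : ℤ), p • T = 0 := fun T ↦ Subtype.ext (by
    rw [AddSubmonoidClass.coe_nsmul, ZeroMemClass.coe_zero, ← natCast_zsmul]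
    exact (Submodule.mem_torsionBy_iff _ _).mp T.2)
  obtain ⟨a, ha⟩ := AddSubgroup.mem_zmultiples_iff.mp
    (mem_zmultiples_of_fixed_of_moved hp.out hcard _ hQ₀ne (hpT Q₀) hQ₀fix hQ'fix hτ hR)
  -- `p ∤ 2 N(v)`
  have hcop : Nat.Coprime p (2 * v.residueCard) := by
    rw [hres]
    exact Nat.Coprime.mul_right ((Nat.coprime_primes hp.out Nat.prime_two).mpr hp2)
      ((Nat.coprime_primes hp.out (primesEquiv v).2).mpr (Ne.symm hℓp))
  -- a sign mismatch would kill `e Q`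
  have hmis : σ • e Q = v.residueCard • e Q → σ • e Q = -(v.residueCard • e Q) → False := by
    intro hA hB
    apply hQ'ne
    have h2 : (2 * v.residueCard) • e Q = 0 := by
      rw [mul_nsmul', two_nsmul, add_eq_zero_iff_eq_neg, ← hB, hA]
    have hdvd : addOrderOf (e Q) ∣ Nat.gcd p (2 * v.residueCard) :=
      Nat.dvd_gcd (addOrderOf_dvd_of_nsmul_eq_zero (hpT _)) (addOrderOf_dvd_of_nsmul_eq_zero h2)
    rw [hcop, Nat.dvd_one, AddMonoid.addOrderOf_eq_one_iff] at hdvd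
    exact hdvd
  -- Frobenius on `e Q` read through `e` (sign of `W`) and through the line `ℤ Q₀` (sign of `W₀`)
  rcases hQσ with ⟨hs, hσQ⟩ | ⟨hs, hσQ⟩ <;> rcases hQ₀σ with ⟨hs₀, hσQ₀⟩ | ⟨hs₀, hσQ₀⟩
  · rw [KrausOesterle1992.lFunction_apply_prime_eq_one_of_hasSplitMultiplicativeReductionAtPrime W _
        ((W.hasSplitMultiplicativeReductionAtPrime_iff_hasSplitMultiplicativeReductionAt v).mpr hs),
      KrausOesterle1992.lFunction_apply_prime_eq_one_of_hasSplitMultiplicativeReductionAtPrime W₀ _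
        ((W₀.hasSplitMultiplicativeReductionAtPrime_iff_hasSplitMultiplicativeReductionAt v).mpr hs₀)]
  · exact (hmis (by rw [← he, hσQ, map_nsmul])
      (by rw [← ha, smul_comm σ a Q₀, hσQ₀, smul_neg, smul_comm a (v.residueCard) Q₀])).elim
  · exact (hmis (by rw [← ha, smul_comm σ a Q₀, hσQ₀, smul_comm a (v.residueCard) Q₀])
      (by rw [← he, hσQ, map_neg, map_nsmul])).elim
  · rw [KrausOesterle1992.lFunction_apply_prime_eq_neg_one_of_not_split W _ hW
        (fun h ↦ hs ((W.hasSplitMultiplicativeReductionAtPrime_iff_hasSplitMultiplicativeReductionAt v).mp h)),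
      KrausOesterle1992.lFunction_apply_prime_eq_neg_one_of_not_split W₀ _ hW₀
        (fun h ↦ hs₀ ((W₀.hasSplitMultiplicativeReductionAtPrime_iff_hasSplitMultiplicativeReductionAt v).mp h))]

/-- **The locus clause (i) SIGN AGREEMENT of line `epsilon_matched_retyping` is automatic.**  In the currency of the
lead's skeleton v3 (`Cruxes/LevelKolyvaginSystemsAdditive/Lines/epsilon_matched_retyping.lean`, sha16 0ec7e4aa): for the
additive curve `W` at `p ≥ 5` (`Addv W p`) and an avatar `W₀` with the same multiplicative primes (`htype`), Hypothesis
♠(1) for `W₀` (`hsp₀`) and a `Γ_ℚ`-equivariant `e : W[p] ≃+ W₀[p]`, the clause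
`hsign : ∀ ℓ, W₀.HasMultiplicativeReductionAtPrime ℓ → W.LFunction ℓ = W₀.LFunction ℓ` holds (a multiplicative `ℓ`
of `W₀` is multiplicative for `W`, hence `≠ p` since `W` is additive at `p`; then
`lFunction_eq_of_addEquiv_geomTorsion_of_hasMultiplicativeReductionAtPrime`).  So `hsign` can be DERIVED inside the
composition `LevelKolyvaginSystemsAdditive_of` and dropped from the (γ)-avatar locus ∕ from the residual stub.
[cite: DarmonDiamondTaylor1995, Prop. 2.12 (c)] [cite: SerreTate1968, §1 Lemma 2] -/
theorem sign_agreement_of_torsionCongr (W W₀ : WeierstrassCurve ℚ) [W.IsElliptic] [W₀.IsElliptic]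
    [W₀.IsGloballyMinimal] (p : ℕ) [Fact p.Prime] (hp : 5 ≤ p) (hadd : Rank1Residual.Addv W p)
    (hsp₀ : ∀ (ℓ : ℕ) [Fact ℓ.Prime], W₀.HasMultiplicativeReductionAtPrime ℓ →
      ¬ p ∣ padicValInt ℓ W₀.minimalDiscriminantInt)
    (htype : ∀ (ℓ : ℕ) [Fact ℓ.Prime],
      W.HasMultiplicativeReductionAtPrime ℓ ↔ W₀.HasMultiplicativeReductionAtPrime ℓ)
    (e : geomTorsion W (p : ℤ) ≃+ geomTorsion W₀ (p : ℤ))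
    (he : ∀ (σ : absoluteGaloisGroup ℚ) (P : geomTorsion W (p : ℤ)), e (σ • P) = σ • e P) :
    ∀ (ℓ : ℕ) [Fact ℓ.Prime], W₀.HasMultiplicativeReductionAtPrime ℓ → W.LFunction ℓ = W₀.LFunction ℓ := by
  intro ℓ _ hℓ₀
  have hℓ : W.HasMultiplicativeReductionAtPrime ℓ := (htype ℓ).mpr hℓ₀
  have hℓp : ℓ ≠ p := by
    rintro rfl
    exact hadd.2 hℓ
  exact lFunction_eq_of_addEquiv_geomTorsion_of_hasMultiplicativeReductionAtPrime W W₀ p (by omega) e he ℓ hℓp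
    hℓ hℓ₀ (hsp₀ ℓ hℓ₀)

end OverQ

end Summit.BirchSwinnertonDyer.BirchSwinnertonDyer.Theorems.AdditiveKoly

end
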